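import Summits.NavierStokesRegularity.NavierStokesRegularity.Theorems.TypeICertificateLadderTargetStretchingLogMean
import HarnessLib

/-!
# Crux `Target` = `TypeICertificateLadder.NoTypeIBlowup` (stmt-NavierStokesRegularity-1217), line
# `depletion-ladder` / ceiling-lift line `ExtremiserTransience`: the log-mean stretching law, PRODUCT FORM
# (depletion × amplitude)

`--supports stmt-NavierStokesRegularity-1217` (helper; sequel of `…TargetStretchingLogMean`). Author: STA lineage
`ns-sta-19551-p1` (g11).

* `hasSmoothExtensionPast_of_sqIntegral_depletion_amplitude` — a flow-wise depletion coefficient `k`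
  (`|∫⟪ω, Du ω⟫(t)| ≤ k(t)·M·‖ω‖₂‖∇ω‖₂` for every bound `M` of `|u(t)|`) and an amplitude majorant
  `m(t) ≥ sup_x ‖u(t,x)‖` from an onset `t₁`, with the PLAIN time integral
  `∫_{t₁}^t (k m)² dτ ≤ ν (ρ² log((T−t₁)/(T−t)) + B)` and `ρ² < 1`, give smooth extension past `T`
  (`σ = k·m·√((T−τ)/ν)` in `hasSmoothExtensionPast_of_logMean_stretching`: the log-time weight cancels);
* `exists_sqIntegral_depletion_amplitude_gt_of_not_hasSmoothExtensionPast` — portrait form: at a singular time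
  the budget `ν(ρ² log + B)` is exceeded for every `ρ² < 1`, `B`, onset, `k`, `m`.

Instances already in the tree (not re-derived): `m = C√ν/√(T−t)` with log-mean of `k²` at most `r²`, `rC < 1`
= `AveragedRung` (stmt-21885, p574441 `rung_of_logMeanDepletion`); `k ≡ κ` universal and
`∫ m² ≤ B' + Aν log(T/(T−t))`, `κ²A < 1` = the log-amplitude rung (p543431
`hasSmoothExtensionPast_of_logIntegral_oscillation`, up to the Galilean gauge); `k ≡ κ`, `m = C√ν/√(T−t)` =
the constant-form rungs. New content: the two factors are charged JOINTLY — what a singular flow must saturate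
in log-time mean is `(k·m)²(T−t)/ν`, so intermittency of either factor below its envelope is spendable (the
`s`-variant of crux K1 `NearExtremalTransience`, `Cruxes/NearExtremalTransience/Lines/birth.md` point 5).

WHAT THIS IS NOT: no depletion and no rate is proved; a per-solution criterion. [folklore]

References: Leray 1934 §§19–20; Lemarié-Rieusset (2016), Thm. 11.2.
-/

noncomputable section

open Set Filter Topology MeasureTheory
open scoped RealInnerProductSpace ENNReal NNReal ContDiff
open Literature.Analysis.FluidPDE

namespace Summit.NavierStokesRegularity.NavierStokesRegularity.Theorems.DepletionLadder

-- the problem directory repeats the summit name (`NavierStokesRegularity/NavierStokesRegularity`)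
set_option linter.dupNamespace false

/-! ## The product form: depletion × amplitude -/

/-- **The product rung (depletion × amplitude, plain time integral).** Let `u` be a classical Leray–Hopf
rapidly-decaying-datum solution on `ℝ³ × [0,T)`. Suppose that from an onset `t₁ ∈ [0,T)` there are a
FLOW-WISE DEPLETION COEFFICIENT `k` (`|∫⟪ω, Du ω⟫(t)| ≤ k(t)·M·‖ω(t)‖₂·‖∇ω(t)‖₂` for every bound
`M` of `|u(t)|`, `t ∈ [t₁,T)`) and an AMPLITUDE MAJORANT `m` (`‖u(t,x)‖ ≤ m(t)` for `t ∈ [t₁,T)`)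
with `(k·m)²` interval integrable on each `[t₁,t]` and
`∫_{t₁}^t (k(τ) m(τ))² dτ ≤ ν · (ρ² log((T−t₁)/(T−t)) + B)` for all `t ∈ [t₁,T)`, where `ρ² < 1`. Then `u`
extends smoothly past `T`. (The log-time weight `1/(T−τ)` of the stretching law cancels against the
`√((T−τ)/ν)` in `σ = k·m·√((T−τ)/ν)`.) Instances: `m = C√ν/√(T−t)` and log-mean of `k²` ≤ `r²` with
`rC < 1` is `AveragedRung` (stmt-21885); `k ≡ (2+√3)/9` and `∫m² ≤ B' + Aν log(T/(T−t))`,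
`((2+√3)/9)²A < 1`, is the log-amplitude rung. [folklore] -/
theorem hasSmoothExtensionPast_of_sqIntegral_depletion_amplitude {ν ρ T t₁ B : ℝ} (hν : 0 < ν)
    (hT : 0 < T) (hρ : ρ ^ 2 < 1) (ht₁ : t₁ ∈ Ico 0 T)
    {u : ℝ → EuclideanSpace ℝ (Fin 3) → EuclideanSpace ℝ (Fin 3)}
    {p : ℝ → EuclideanSpace ℝ (Fin 3) → ℝ}
    (hsol : IsClassicalNSSolutionOn (Ico 0 T) ν 0 u p) (hLH : IsLerayHopfOn T ν 0 (u 0) u)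
    (hdec : HasRapidSpatialDecay (u 0))
    {k m : ℝ → ℝ}
    (hflow : ∀ t ∈ Ico t₁ T, ∀ M : ℝ, (∀ x, ‖u t x‖ ≤ M) →
      |∫ x, ⟪curl (u t) x, fderiv ℝ (u t) x (curl (u t) x)⟫| ≤
        k t * M * Real.sqrt (∫ x, ‖curl (u t) x‖ ^ 2) *
          Real.sqrt (∫ x, frobeniusNormSq (fderiv ℝ (curl (u t)) x)))
    (hamp : ∀ t ∈ Ico t₁ T, ∀ x, ‖u t x‖ ≤ m t)
    (hii : ∀ t ∈ Ico t₁ T, IntervalIntegrable (fun τ => (k τ * m τ) ^ 2) volume t₁ t)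
    (hint : ∀ t ∈ Ico t₁ T, ∫ τ in t₁..t, (k τ * m τ) ^ 2 ≤
      ν * (ρ ^ 2 * Real.log ((T - t₁) / (T - t)) + B)) :
    HasSmoothExtensionPast ν 0 u T := by
  -- the majorant `σ = k·m·√((T−τ)/ν)` of the stretching number
  set σ : ℝ → ℝ := fun τ => k τ * m τ * Real.sqrt ((T - τ) / ν) with hσdef
  -- on `[t₁, t] ⊂ [0,T)` the weight `σ²/(T−τ)` is `(k m)²/ν`
  have hστ : ∀ τ, τ < T → σ τ ^ 2 / (T - τ) = (k τ * m τ) ^ 2 / ν := by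
    intro τ hτ
    have hTτ : 0 < T - τ := sub_pos.2 hτ
    rw [hσdef]
    simp only
    rw [mul_pow, Real.sq_sqrt (div_nonneg hTτ.le hν.le)]
    field_simp
  have hii' : ∀ t ∈ Ico t₁ T, IntervalIntegrable (fun τ => σ τ ^ 2 / (T - τ)) volume t₁ t := by
    intro t ht
    have h := (hii t ht).div_const ν
    refine h.congr fun τ hτ => ?_
    rw [uIoc_of_le ht.1] at hτ
    exact (hστ τ (hτ.2.trans_lt ht.2)).symm
  have hS : ∀ t ∈ Ico t₁ T, ∫ x, ⟪curl (u t) x, fderiv ℝ (u t) x (curl (u t) x)⟫ ≤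
      σ t * Real.sqrt (ν / (T - t)) * Real.sqrt (∫ x, ‖curl (u t) x‖ ^ 2) *
        Real.sqrt (∫ x, frobeniusNormSq (fderiv ℝ (curl (u t)) x)) := by
    intro t ht
    have hTt : 0 < T - t := sub_pos.2 ht.2
    have hσt : σ t * Real.sqrt (ν / (T - t)) = k t * m t := by
      rw [hσdef]
      simp only
      rw [mul_assoc, ← Real.sqrt_mul (div_nonneg hTt.le hν.le),
        show (T - t) / ν * (ν / (T - t)) = 1 by field_simp, Real.sqrt_one, mul_one]
    rw [hσt]
    exact (le_abs_self _).trans (hflow t ht (m t) (hamp t ht))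
  have hmean : ∀ t ∈ Ico t₁ T, ∫ τ in t₁..t, σ τ ^ 2 / (T - τ) ≤
      ρ ^ 2 * Real.log ((T - t₁) / (T - t)) + B := by
    intro t ht
    have heq : ∫ τ in t₁..t, σ τ ^ 2 / (T - τ) = ∫ τ in t₁..t, (k τ * m τ) ^ 2 / ν := by
      refine intervalIntegral.integral_congr fun τ hτ => ?_
      rw [uIcc_of_le ht.1] at hτ
      exact hστ τ (hτ.2.trans_lt ht.2)
    rw [heq, intervalIntegral.integral_div, div_le_iff₀ hν]
    linarith [hint t ht]
  exact hasSmoothExtensionPast_of_logMean_stretching hν hT hρ ht₁ hsol hLH hdec hii' hS hmean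

/-- **Portrait, product form.** At a singular time of a classical Leray–Hopf rapidly-decaying-datum solution,
for every onset, every flow-wise depletion coefficient `k` and every amplitude
majorant `m` on `[t₁,T)` (with `(k m)²` locally interval integrable), every `ρ² < 1` and every `B`, there is
`t ∈ [t₁,T)` with `ν (ρ² log((T−t₁)/(T−t)) + B) < ∫_{t₁}^t (k m)²`: what a singular flow saturates in log-time
mean is the PRODUCT depletion × amplitude (`(k·m)² (T−t)/ν`, mean `≥ 1`). [folklore] -/
theorem exists_sqIntegral_depletion_amplitude_gt_of_not_hasSmoothExtensionPast {ν ρ T t₁ B : ℝ}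
    (hν : 0 < ν) (hT : 0 < T) (hρ : ρ ^ 2 < 1) (ht₁ : t₁ ∈ Ico 0 T)
    {u : ℝ → EuclideanSpace ℝ (Fin 3) → EuclideanSpace ℝ (Fin 3)}
    {p : ℝ → EuclideanSpace ℝ (Fin 3) → ℝ}
    (hsol : IsClassicalNSSolutionOn (Ico 0 T) ν 0 u p) (hLH : IsLerayHopfOn T ν 0 (u 0) u)
    (hdec : HasRapidSpatialDecay (u 0)) (hsing : ¬ HasSmoothExtensionPast ν 0 u T)
    {k m : ℝ → ℝ}
    (hflow : ∀ t ∈ Ico t₁ T, ∀ M : ℝ, (∀ x, ‖u t x‖ ≤ M) →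
      |∫ x, ⟪curl (u t) x, fderiv ℝ (u t) x (curl (u t) x)⟫| ≤
        k t * M * Real.sqrt (∫ x, ‖curl (u t) x‖ ^ 2) *
          Real.sqrt (∫ x, frobeniusNormSq (fderiv ℝ (curl (u t)) x)))
    (hamp : ∀ t ∈ Ico t₁ T, ∀ x, ‖u t x‖ ≤ m t)
    (hii : ∀ t ∈ Ico t₁ T, IntervalIntegrable (fun τ => (k τ * m τ) ^ 2) volume t₁ t) :
    ∃ t ∈ Ico t₁ T, ν * (ρ ^ 2 * Real.log ((T - t₁) / (T - t)) + B) < ∫ τ in t₁..t, (k τ * m τ) ^ 2 := by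
  by_contra h
  push Not at h
  exact hsing (hasSmoothExtensionPast_of_sqIntegral_depletion_amplitude hν hT hρ ht₁ hsol hLH hdec
    hflow hamp hii h)

end Summit.NavierStokesRegularity.NavierStokesRegularity.Theorems.DepletionLadder

end
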